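import Summits.HodgeConjecture.HodgeConjecture.Theses.EisensteinMiddleThird
import Literature.AlgebraicGeometry.HodgeTheory.LefschetzOneOneHolds
import Literature.AlgebraicGeometry.HodgeTheory.MotivatedClassesLefschetzRange
import Literature.AlgebraicGeometry.HodgeTheory.GysinFormalismPushforward
import Literature.AlgebraicGeometry.HodgeTheory.AlgebraicClassesHodgeTypeHolds
import Literature.AlgebraicGeometry.HodgeTheory.HodgeTypeConjugation
import HarnessLib

/-!
# Split assembly — the glue item `EisensteinTowerHodgeOfPieces` (stmt-HodgeConjecture-17631) PROVED

`X₁ ∧ X₂ ∧ X₃ → EisensteinTowerHodge` for the crux-strategist's BC2-redirect decomposition of the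
deciding crux `EisensteinTowerHodge` (stmt-HodgeConjecture-14409) of route EisensteinMiddleThird:
X₁ = `ConiveauOneMiddleFourfold` (stmt-18997, support, known-grade; spelled inline in the glue item),
X₂ = `TowerCuspidalMiddle` (stmt-19001, crux), X₃ = `TowerEisensteinMiddle` (stmt-19002, crux) — all
three are decls of the route file (rev ≥ 12). `eisensteinTowerHodgeOfPieces_proof` has EXACTLY the type
of the route decl `EisensteinMiddleThird.EisensteinTowerHodgeOfPieces`; a prover can land this file
verbatim as `Theorems/EisensteinMiddleThirdEisensteinTowerHodgeOfPieces.lean` (Theorems/ is prover-only),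
after which `route edit --split EisensteinTowerHodge --into … --glue-by …` makes the crux DERIVED.

NOT a logic seam (≈40 tactic lines): Hodge-model conjunct from the sector datum; degrees `2p ≠ 4` by
the tree's PROVED Lefschetz (1,1) + hard Lefschetz; degree 4: the boundary is a proper closed subset
(codimension ≥ 1), Eisenstein correction (X₃), cuspidal correction (X₂), coniveau absorption (X₁).
-/

noncomputable section

set_option linter.dupNamespace false

namespace Summit.HodgeConjecture.HodgeConjecture.Theses.EisensteinMiddleThird

open scoped BigOperators Topology Manifold Classical Matrix
open CategoryTheory

open Literature.AlgebraicGeometry Literature.AlgebraicGeometry.Motives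
  Literature.AlgebraicGeometry.HodgeTheory Literature.AlgebraicTopology.SingularHomology

/-- Rational classes are closed under subtraction. -/
theorem isRationalClass_sub' {Y : Type} [TopologicalSpace Y] {k : ℕ}
    {c c' : singularCohomology ℂ ℂ Y k} (hc : IsRationalClass c) (hc' : IsRationalClass c') :
    IsRationalClass (c - c') := by
  have h := hc.add (hc'.smul (-1))
  simpa [sub_eq_add_neg] using h

/-- **The glue item, proved** (non-trivial glue): the Hodge conjecture in ALL degrees on the Eisenstein
Picard-modular sector from the three pieces. Hodge-model conjunct: the `A` of the sector datum. Degrees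
`2p ≠ 4`: the tree's PROVED Lefschetz `(1,1)` (`lefschetzOneOne_rational_holds`) and hard Lefschetz
(`nonempty_hardLefschetzNFold_holds`) through `mem_algebraicClasses_of_lefschetzRange`. Degree 4: the
boundary `Z` is a PROPER Zariski-closed subset (the ball covers a non-empty off-locus), hence of
codimension `≥ 1` in the irreducible `X` (`one_le_coheight_of_mem_of_isClosed`); subtract the Eisenstein
correction `a₁` (piece 3), then the cuspidal correction `a₂` (piece 2, applicable because `c - a₁` is again
rational of type `(2,2)` — algebraic classes are of Hodge type `(2,2)`,
`isOfHodgeType_of_mem_algebraicClasses_of_isSmoothProjective` — and dies on the boundary threefolds); the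
remainder is supported on `Z`, so of coniveau `≥ 1` (`mem_supportedClasses_of_restrictCompl_eq_zero`), so
algebraic by piece 1; and `algebraicClasses X 2` is a submodule. -/
theorem eisensteinTowerHodgeOfPieces_proof : EisensteinTowerHodgeOfPieces := by
  intro h₁ h₂ h₃ X hX hsec
  obtain ⟨A, Z, S, N, π, hdata⟩ := hsec
  refine ⟨⟨A⟩, ?_⟩
  intro p c hc hpp
  by_cases hp : p = 2
  · subst hp
    -- the boundary is a proper Zariski-closed subset of the irreducible fourfold `X`
    have hZ : IsClosed Z := hdata.1
    have hZne : Z ≠ Set.univ := by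
      obtain ⟨hmaps, -, -⟩ := hdata.2.2.2.2.2.1
      intro hZu
      have h0 : (0 : EuclideanSpace ℂ (Fin 4)) ∈ Metric.ball (0 : EuclideanSpace ℂ (Fin 4)) 1 :=
        Metric.mem_ball_self one_pos
      have hmem := hmaps h0
      simp only [Set.mem_setOf_eq, hZu, Set.mem_univ, not_true_eq_false] at hmem
    have hcodim : ∀ z ∈ Z, ((1 : ℕ) : ℕ∞) ≤ Order.coheight z := fun z hz ↦ by
      simpa using one_le_coheight_of_mem_of_isClosed hX hZ hZne hz
    -- Eisenstein correction: kill the restrictions to the boundary threefolds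
    obtain ⟨a₁, ha₁, ha₁r, hE⟩ := h₃ hX A Z S N π hdata c hc hpp
    have hc₁r : IsRationalClass (c - a₁) := isRationalClass_sub' hc ha₁r
    have hc₁h : IsOfHodgeType 4 X (2 * 2) 2 2 (c - a₁) :=
      hpp.sub hX (isOfHodgeType_of_mem_algebraicClasses_of_isSmoothProjective hX 2 ha₁)
    -- cuspidal correction: the interior part is algebraic modulo classes supported on `Z`
    obtain ⟨a₂, ha₂, ha₂r, hC⟩ := h₂ hX A Z S N π hdata (c - a₁) hc₁r hc₁h hE
    -- the remainder is supported on `Z`, hence of coniveau `≥ 1`, hence algebraic (piece 1)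
    have hrr : IsRationalClass (c - a₁ - a₂) := isRationalClass_sub' hc₁r ha₂r
    have hrh : IsOfHodgeType 4 X (2 * 2) 2 2 (c - a₁ - a₂) :=
      hc₁h.sub hX (isOfHodgeType_of_mem_algebraicClasses_of_isSmoothProjective hX 2 ha₂)
    have hrs : c - a₁ - a₂ ∈ supportedClasses X (2 * 2) 1 :=
      mem_supportedClasses_of_restrictCompl_eq_zero hZ hcodim hC
    have hra : c - a₁ - a₂ ∈ algebraicClasses X 2 := h₁ hX _ hrr hrh hrs
    have hsum : c = a₁ + a₂ + (c - a₁ - a₂) := by abel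
    rw [hsum]
    exact Submodule.add_mem _ (Submodule.add_mem _ ha₁ ha₂) hra
  · -- Lefschetz range `p ≤ 1 ∨ 4 ≤ p + 1`: proved in the tree
    exact mem_algebraicClasses_of_lefschetzRange lefschetzOneOne_rational_holds
      (nonempty_hardLefschetzNFold_holds 4 X) hX (by omega) c hc hpp

/-- The same assembly with the pieces BY NAME (X₁ = `ConiveauOneMiddleFourfold` is definitionally the
inline first hypothesis of the glue item). -/
theorem eisensteinTowerHodge_of_pieces (h₁ : ConiveauOneMiddleFourfold) (h₂ : TowerCuspidalMiddle)
    (h₃ : TowerEisensteinMiddle) : EisensteinTowerHodge :=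
  eisensteinTowerHodgeOfPieces_proof h₁ h₂ h₃

end Summit.HodgeConjecture.HodgeConjecture.Theses.EisensteinMiddleThird

end
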